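import Summits.Parity.GeneralizedHardyLittlewood.Theorems.LeeYangFibresCellParityLawKernelInductionAux
import HarnessLib

/-!
# Route `LeeYangFibres`, crux `CellParityLaw` (stmt-Parity-14109), line `section-annihilator`:
# the induction `KernelInduction` (skeleton v19) — restricting the prime sums to `p ≤ x^{1/(n+1)}`
# (`InductionStepAux.stub_sumRestrict`, sub-goal S2 of `stub_inductionStep`)

Skeleton v19 (lead c6). In the induction step the exact recursion (`RecursionIdentity`) writes
`C_{n+1}(𝒜; x, z)` as the sum over ALL primes `z < p ≤ x` — the set
`Q = (Ioc 0 ⌊x⌋₊).filter (p prime ∧ z < p)` — of the fibre cells `C_n(𝒜_p; x/p, p − 1/2)`; likewise the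
model prime sum and the weighted pair sum are sums over `Q` of `I_n(log(x/p)/log p) · (…)`. Only the primes
`p ≤ x^{1/(n+1)}` — the set `P = (Ioc ⌊z⌋₊ ⌊x^{1/(n+1)}⌋₊).filter Nat.Prime` — contribute: for `p ∈ Q ∖ P` one
has `⌊x^{1/(n+1)}⌋₊ < p`, so `x^{1/(n+1)} < p` and `x < p^{n+1}`, whence

* the fibre cell vanishes (`VanishAux.fibre_roughCellSum_eq_zero`: an element of the cell has `n` prime
  factors `≥ p` and is `≤ x/p < p^n`), and
* `x/p < p^n` gives `log(x/p)/log p < n`, so `I_n(log(x/p)/log p) = 0` (`roughCellDensity_of_lt`).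

Hence both sums over `Q` equal the sums over `P` (`Finset.sum_subset`), `P ⊆ Q` (as `x^{1/(n+1)} ≤ x` for
`x ≥ 1` and `⌊z⌋₊ < p ↔ z < p` for `z ≥ 0`), and every `p ∈ P` is a prime with `z < p ≤ x^{1/(n+1)}`.
Elementary bookkeeping; no analytic input.

References: E. Bombieri, RIMS Kôkyûroku 294 (1977) p. 5 [BombieriRIMS1977] (the Buchstab recursion of the
`P_r` laws); H. L. Montgomery, R. C. Vaughan, *Multiplicative Number Theory I*, §7.2 (7.43) [MontgomeryVaughan2007].
-/

noncomputable section

open scoped BigOperators Classical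
open Finset Literature.NumberTheory.Sieve

namespace Summit.Parity.GeneralizedHardyLittlewood.Cruxes.CellParityLaw.SectionAnnihilator

/-! ## Elementary range lemmas -/

namespace SumRestrictAux

/-- `x^{1/(n+1)} ≤ x` for `x ≥ 1` (the exponent `1/(n+1)` is at most `1`). -/
theorem rpow_inv_succ_le_self {x : ℝ} (hx : 1 ≤ x) (n : ℕ) : x ^ (1 / ((n : ℝ) + 1)) ≤ x := by
  have hn0 : (0 : ℝ) ≤ n := Nat.cast_nonneg n
  have hn : (0 : ℝ) < (n : ℝ) + 1 := by linarith
  have h1 : 1 / ((n : ℝ) + 1) ≤ 1 := by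
    rw [div_le_one hn]
    linarith
  calc x ^ (1 / ((n : ℝ) + 1)) ≤ x ^ (1 : ℝ) := Real.rpow_le_rpow_of_exponent_le hx h1
    _ = x := Real.rpow_one x

/-- `(x^{1/(n+1)})^{n+1} = x` for `x ≥ 0`. -/
theorem rpow_inv_succ_pow {x : ℝ} (hx : 0 ≤ x) (n : ℕ) :
    (x ^ (1 / ((n : ℝ) + 1))) ^ (n + 1) = x := by
  have e : (1 / ((n : ℝ) + 1)) = ((n + 1 : ℕ) : ℝ)⁻¹ := by
    push_cast
    rw [one_div]
  rw [e, Real.rpow_inv_natCast_pow hx (Nat.succ_ne_zero n)]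

/-- If `⌊x^{1/(n+1)}⌋₊ < p` then `x < p^{n+1}` (`x ≥ 0`): indeed `x^{1/(n+1)} < p`, and raise to the power
`n + 1`. -/
theorem lt_pow_succ_of_floor_lt {x : ℝ} (hx : 0 ≤ x) {n p : ℕ}
    (h : ⌊x ^ (1 / ((n : ℝ) + 1))⌋₊ < p) : x < (p : ℝ) ^ (n + 1) := by
  have hyp : x ^ (1 / ((n : ℝ) + 1)) < (p : ℝ) := Nat.lt_of_floor_lt h
  calc x = (x ^ (1 / ((n : ℝ) + 1))) ^ (n + 1) := (rpow_inv_succ_pow hx n).symm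
    _ < (p : ℝ) ^ (n + 1) := pow_lt_pow_left₀ hyp (Real.rpow_nonneg hx _) (Nat.succ_ne_zero n)

/-- If `x < p^{n+1}` with `0 < x` and `2 ≤ p`, then `x/p < p^n`, so `log(x/p)/log p < n` and the cell
density `I_n(log(x/p)/log p)` vanishes (`roughCellDensity_of_lt`). -/
theorem roughCellDensity_fibre_eq_zero {x : ℝ} {p n : ℕ} (hx : 0 < x) (hp : 2 ≤ p)
    (hxp : x < (p : ℝ) ^ (n + 1)) : roughCellDensity n (Real.log (x / p) / Real.log p) = 0 := by
  have hp1 : (1 : ℝ) < p := by exact_mod_cast hp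
  have hp0 : (0 : ℝ) < p := by linarith
  have hlogp : 0 < Real.log p := Real.log_pos hp1
  refine roughCellDensity_of_lt n ?_
  rw [div_lt_iff₀ hlogp, ← Real.log_pow]
  refine Real.log_lt_log (div_pos hx hp0) ?_
  rw [div_lt_iff₀ hp0, ← pow_succ]
  exact hxp

end SumRestrictAux

/-! ## The restriction of the prime sums -/

namespace InductionStepAux

open SumRestrictAux in
/-- **`stub_sumRestrict`** (registered sub-goal S2 of `stub_inductionStep`, skeleton v19, line
`section-annihilator`): restriction of the prime sums of the induction step to `p ≤ x^{1/(n+1)}`.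
With `Q = (Ioc 0 ⌊x⌋₊).filter (p prime ∧ z < p)` (all primes `z < p ≤ x`) and
`P = (Ioc ⌊z⌋₊ ⌊x^{1/(n+1)}⌋₊).filter Nat.Prime` (primes `z < p ≤ x^{1/(n+1)}`), for `1 ≤ n`, `0 ≤ z`, `1 ≤ x`:
(i) `Σ_{p ∈ Q} C_n(𝒜_p; x/p, p − 1/2) = Σ_{p ∈ P} C_n(𝒜_p; x/p, p − 1/2)`;
(ii) for every weight `w`, `Σ_{p ∈ Q} I_n(log(x/p)/log p) w(p) = Σ_{p ∈ P} I_n(log(x/p)/log p) w(p)`;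
(iii) every `p ∈ P` is a prime with `z < p ≤ x^{1/(n+1)}`; (iv) `P ⊆ Q`.
For `p ∈ Q ∖ P` one has `x < p^{n+1}`, so the fibre cell is empty (`VanishAux.fibre_roughCellSum_eq_zero`)
and `I_n(log(x/p)/log p) = 0` (`log(x/p)/log p < n`, `roughCellDensity_of_lt`). -/
theorem stub_sumRestrict : ∀ (𝒜 : SieveSequence) (x z : ℝ) (n : ℕ), 1 ≤ n → 0 ≤ z → 1 ≤ x →
    (∑ p ∈ (Finset.Ioc 0 ⌊x⌋₊).filter (fun p : ℕ => p.Prime ∧ z < (p : ℝ)),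
        roughCellSum (fibreSeq 𝒜 p) (x / p) ((p : ℝ) - 1 / 2) n =
      ∑ p ∈ (Finset.Ioc ⌊z⌋₊ ⌊x ^ (1 / ((n : ℝ) + 1))⌋₊).filter Nat.Prime,
        roughCellSum (fibreSeq 𝒜 p) (x / p) ((p : ℝ) - 1 / 2) n) ∧
    (∀ w : ℕ → ℝ,
      ∑ p ∈ (Finset.Ioc 0 ⌊x⌋₊).filter (fun p : ℕ => p.Prime ∧ z < (p : ℝ)),
          roughCellDensity n (Real.log (x / p) / Real.log p) * w p =
        ∑ p ∈ (Finset.Ioc ⌊z⌋₊ ⌊x ^ (1 / ((n : ℝ) + 1))⌋₊).filter Nat.Prime,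
          roughCellDensity n (Real.log (x / p) / Real.log p) * w p) ∧
    (∀ p ∈ (Finset.Ioc ⌊z⌋₊ ⌊x ^ (1 / ((n : ℝ) + 1))⌋₊).filter Nat.Prime,
        p.Prime ∧ z < (p : ℝ) ∧ (p : ℝ) ≤ x ^ (1 / ((n : ℝ) + 1))) ∧
    (Finset.Ioc ⌊z⌋₊ ⌊x ^ (1 / ((n : ℝ) + 1))⌋₊).filter Nat.Prime ⊆
      (Finset.Ioc 0 ⌊x⌋₊).filter (fun p : ℕ => p.Prime ∧ z < (p : ℝ)) := by
  intro 𝒜 x z n _hn hz hx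
  have hx0 : 0 < x := one_pos.trans_le hx
  have hy0 : 0 ≤ x ^ (1 / ((n : ℝ) + 1)) := Real.rpow_nonneg hx0.le _
  have hyx : x ^ (1 / ((n : ℝ) + 1)) ≤ x := rpow_inv_succ_le_self hx n
  -- (iv) `P ⊆ Q`
  have hPQ : (Finset.Ioc ⌊z⌋₊ ⌊x ^ (1 / ((n : ℝ) + 1))⌋₊).filter Nat.Prime ⊆
      (Finset.Ioc 0 ⌊x⌋₊).filter (fun p : ℕ => p.Prime ∧ z < (p : ℝ)) := by
    intro p hp
    rw [Finset.mem_filter, Finset.mem_Ioc] at hp ⊢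
    obtain ⟨⟨hzp, hpy⟩, hpp⟩ := hp
    exact ⟨⟨hpp.pos, hpy.trans (Nat.floor_le_floor hyx)⟩, hpp, (Nat.floor_lt hz).mp hzp⟩
  -- (iii) the members of `P`
  have hmem : ∀ p ∈ (Finset.Ioc ⌊z⌋₊ ⌊x ^ (1 / ((n : ℝ) + 1))⌋₊).filter Nat.Prime,
      p.Prime ∧ z < (p : ℝ) ∧ (p : ℝ) ≤ x ^ (1 / ((n : ℝ) + 1)) := by
    intro p hp
    rw [Finset.mem_filter, Finset.mem_Ioc] at hp
    obtain ⟨⟨hzp, hpy⟩, hpp⟩ := hp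
    exact ⟨hpp, (Nat.floor_lt hz).mp hzp, (Nat.le_floor_iff hy0).mp hpy⟩
  -- off `P` the prime is large: `x < p^{n+1}`
  have hbig : ∀ p ∈ (Finset.Ioc 0 ⌊x⌋₊).filter (fun p : ℕ => p.Prime ∧ z < (p : ℝ)),
      p ∉ (Finset.Ioc ⌊z⌋₊ ⌊x ^ (1 / ((n : ℝ) + 1))⌋₊).filter Nat.Prime →
        p.Prime ∧ x < (p : ℝ) ^ (n + 1) := by
    intro p hpQ hpP
    rw [Finset.mem_filter, Finset.mem_Ioc] at hpQ
    obtain ⟨-, hpp, hzp⟩ := hpQ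
    have hfl : ⌊x ^ (1 / ((n : ℝ) + 1))⌋₊ < p := by
      refine not_le.mp fun hle => hpP ?_
      exact Finset.mem_filter.mpr ⟨Finset.mem_Ioc.mpr ⟨(Nat.floor_lt hz).mpr hzp, hle⟩, hpp⟩
    exact ⟨hpp, lt_pow_succ_of_floor_lt hx0.le hfl⟩
  refine ⟨?_, fun w => ?_, hmem, hPQ⟩
  · -- (i) the fibre cells vanish off `P`
    refine (Finset.sum_subset hPQ fun p hpQ hpP => ?_).symm
    obtain ⟨hpp, hxp⟩ := hbig p hpQ hpP
    exact VanishAux.fibre_roughCellSum_eq_zero 𝒜 hpp.one_lt.le hxp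
  · -- (ii) the cell densities vanish off `P`
    refine (Finset.sum_subset hPQ fun p hpQ hpP => ?_).symm
    obtain ⟨hpp, hxp⟩ := hbig p hpQ hpP
    rw [roughCellDensity_fibre_eq_zero hx0 hpp.two_le hxp, zero_mul]

end InductionStepAux

end Summit.Parity.GeneralizedHardyLittlewood.Cruxes.CellParityLaw.SectionAnnihilator

end
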